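import Summits.QuantumFields.YangMills.Theorems.LuscherReductionTwistedTraceScalingBOStiffFlatBridge
import Summits.QuantumFields.YangMills.Theorems.LuscherReductionTwistedTraceScalingBOStiffJumpFloor
import Summits.QuantumFields.YangMills.Theorems.FlatTubeReductionStiffKCentral
import HarnessLib


/-!
# (B-ST) K-port, part 8: the JUMP FLOOR `hJ` and the FLAT POINCARÉ hypothesis `hflat` of the central fibre door, at a GENERAL CAP CONSTANT `K ≥ 1`
# (route `FlatTubeReduction`, crux K1 `NearFlatRatioLaw` stmt-QuantumFields-24720, line `ratepack_v2`, stub `stub_hST_A`; seat `ym-line-ftr-p1` g20; R2b1 RECORD rung — no summit statement is proved here)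

Lane A's ✓`…BOStiffJumpFloor` §1–§3 and ✓`…BOStiffFlatBridge` §2 VERBATIM with the cap constant `43` of `recordChi L s 43 M β` replaced by a parameter `K` (`K ≥ 1` where a
smallness is used; the rate twin's stub `stub_hST_A` needs `K = 42·max 1 (|Site 3 L|/7) + 1` at `s = 1/6`), in the K-vocabulary `cWK`/`cZK`/`cΛK`/`cJ0K` of ✓`…FlatTubeReductionStiffKDefs`:
* `cZK_nonneg`, `measurable_cJ0K`, `abs_cJ0K_le` — data clauses of `spec_gap_inputs` for `J₀ = cJ0K`;
* ★★ `cLambdaK_mul_cZK_le`, ★★ `cLambdaK_mul_cZK_le_three`, ★★★ `hJ_record_K` — the jump floor with `cJ = 1/6`, for ALL `s, K, M`, eventually in `β`;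
* `setIntegral_cD_le_cZK`, ★★★ `hflat_record_K` — the flat Poincaré hypothesis for the record's central fibre door at cap constant `K`.
HONEST FRAMING: text port (slot substitution `43 ↦ K`) of lane A's bookkeeping for a stub of the crux K1 of the CONDITIONAL route R2b1 (RECORD rung); no new mathematics; not infinite volume,
not a gap, not Clay.
-/

set_option autoImplicit false

noncomputable section

open MeasureTheory Filter Topology Real
open scoped BigOperators RealInnerProductSpace ENNReal NNReal
open Literature.MathematicalPhysics.QuantumFieldTheory
open Literature.MathematicalPhysics.QuantumLattice

namespace Summit.QuantumFields.YangMills.Theorems.FemtoTransferGap.TwoLattice.ConstTube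

open Summit.QuantumFields.YangMills.Theorems.FemtoTransferGap
open Summit.QuantumFields.YangMills.Theorems.FemtoTransferGap.TwoLattice
open Summit.QuantumFields.YangMills.Theorems.FemtoTransferGap.TwoLattice.Avg
open Summit.QuantumFields.YangMills.Theorems.FemtoTransferGap.TwoLattice.Stiff
open Summit.QuantumFields.YangMills.Theorems.FemtoTransferGap.TwoLattice.GnChart
open Summit.QuantumFields.YangMills.Theorems.FemtoTransferGap.TwoLattice.Cov
open Summit.QuantumFields.YangMills.Theorems.FemtoTransferGap.TwoLattice.Toron
open Literature.Analysis.SegalBargmann (vacCoef vacCoef_pos)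

variable {L : ℕ} [NeZero L]

/-! ## §1 The data clauses for `J₀ = cJ0K` -/

/-- `0 ≤ cZK`. [folklore] -/
theorem cZK_nonneg (s K M β : ℝ) : 0 ≤ cZK L s K M β := by
  unfold cZK
  exact integral_nonneg fun x => mul_nonneg (sq_nonneg _) ((softWeight_recordChi_props (L := L) s K M β).2.2.1 _)

/-- `cJ0K` is jointly measurable. [folklore] -/
theorem measurable_cJ0K (s K M β : ℝ) : Measurable (Function.uncurry (cJ0K L s K M β)) := by
  have hΘm := measurable_cΘ (L := L) β
  have h : Measurable fun p : (Edge 3 L → Fin 3 → ℝ) × (Edge 3 L → Fin 3 → ℝ) => cΘ L β p.1 * cK L β p.1 p.2 * cΘ L β p.2 * (cZK L s K M β / cIk L β) :=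
    (((hΘm.comp measurable_fst).mul (measurable_cK (L := L) β)).mul (hΘm.comp measurable_snd)).mul_const _
  exact h

/-- `|cJ0K| ≤ cZK/cIk` (`β ≥ 0`). [folklore] -/
theorem abs_cJ0K_le {β : ℝ} (hβ : 0 ≤ β) (s K M : ℝ) (x y : Edge 3 L → Fin 3 → ℝ) : |cJ0K L s K M β x y| ≤ cZK L s K M β / cIk L β := by
  obtain ⟨-, hΘ1, -⟩ := cΘ_data (L := L) β
  have hK := cK_pos_le_one (L := L) hβ x y
  have hq : 0 ≤ cZK L s K M β / cIk L β := div_nonneg (cZK_nonneg (L := L) s K M β) (cIk_pos (L := L) hβ).le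
  unfold cJ0K
  rw [abs_mul, abs_of_nonneg hq, abs_mul, abs_mul, abs_of_pos hK.1]
  have h1 : |cΘ L β x| * cK L β x y * |cΘ L β y| ≤ 1 := mul_le_one₀ (mul_le_one₀ (hΘ1 _) hK.1.le hK.2) (abs_nonneg _) (hΘ1 _)
  calc |cΘ L β x| * cK L β x y * |cΘ L β y| * (cZK L s K M β / cIk L β) ≤ 1 * (cZK L s K M β / cIk L β) := mul_le_mul_of_nonneg_right h1 hq
    _ = _ := one_mul _

set_option maxHeartbeats 800000 in
-- long product-measure bookkeeping.
/-- ★★ **Integrating the upper twin against `cΘ ⊗ cΘ`**: eventually in `β`, for all `s, M`,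
`cΛK·cZK ≤ (3/2)·cA·cIk + (e^{2β})^{|E|}e^{−ℓ⁴/(144L²)}·(∫cΘ dπ)²`. [cite: Luscher1983, §3] -/
theorem cLambdaK_mul_cZK_le (hL : Nonempty (NzSite L)) :
    ∀ᶠ β : ℝ in atTop, ∀ s K M : ℝ, cΛK L s K M β * cZK L s K M β ≤
      3 / 2 * cA L β * cIk L β + Real.exp (2 * β) ^ Fintype.card (Edge 3 L) * Real.exp (-(btLog β ^ 4 / (144 * (L : ℝ) ^ 2))) * (∫ x, cΘ L β x ∂orthoTransverse L) ^ 2 := by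
  haveI := isFiniteMeasure_orthoTransverse L
  filter_upwards [cM_upper (L := L) hL (by norm_num : (0 : ℝ) < 1 / 2), eventually_ge_atTop (0 : ℝ)] with β hup hβ s K M
  set t := Real.exp (2 * β) ^ Fintype.card (Edge 3 L) * Real.exp (-(btLog β ^ 4 / (144 * (L : ℝ) ^ 2))) with ht
  have ht0 : 0 ≤ t := by rw [ht]; positivity
  obtain ⟨hΘm, hΘ1, hΘ0⟩ := cΘ_data (L := L) β
  have hKm := measurable_cK (L := L) β
  have hK1 : ∀ x y, |cK L β x y| ≤ 1 := fun x y => by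
    obtain ⟨h0, h1⟩ := cK_pos_le_one (L := L) hβ x y; rw [abs_of_pos h0]; exact h1
  have hA0 := (cA_pos (L := L) β).le
  -- the numerator of cΛK
  set N := ∫ x, ∫ y, cΘ L β x * cM L β x y * cΘ L β y ∂orthoTransverse L ∂orthoTransverse L with hN
  have hRHS0 : 0 ≤ 3 / 2 * cA L β * cIk L β + t * (∫ x, cΘ L β x ∂orthoTransverse L) ^ 2 := by
    have := (cIk_pos (L := L) hβ).le; positivity
  -- pointwise
  obtain ⟨CM, hCM⟩ := cM_bounds (L := L) β
  have hpt : ∀ p : (Edge 3 L → Fin 3 → ℝ) × (Edge 3 L → Fin 3 → ℝ),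
      cΘ L β p.1 * cM L β p.1 p.2 * cΘ L β p.2 ≤ 3 / 2 * cA L β * (cΘ L β p.1 * cK L β p.1 p.2 * cΘ L β p.2) + t * (cΘ L β p.1 * cΘ L β p.2) := by
    rintro ⟨x, y⟩
    simp only
    by_cases hx : x ∈ cS L β
    · by_cases hy : y ∈ cS L β
      · have h := hup x hx y hy
        change cM L β x y ≤ (1 + 1 / 2) * (cA L β * cK L β x y) + t at h
        have := mul_le_mul_of_nonneg_left h (mul_nonneg (hΘ0 x) (hΘ0 y))
        nlinarith [this]
      · rw [cΘ_eq_zero_of_not_mem_cS β y hy]; simp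
    · rw [cΘ_eq_zero_of_not_mem_cS β x hx]; simp
  have hF : Measurable fun p : (Edge 3 L → Fin 3 → ℝ) × (Edge 3 L → Fin 3 → ℝ) => cΘ L β p.1 * cM L β p.1 p.2 * cΘ L β p.2 :=
    ((hΘm.comp measurable_fst).mul (measurable_cM (L := L) β)).mul (hΘm.comp measurable_snd)
  have hFb : ∀ p : (Edge 3 L → Fin 3 → ℝ) × (Edge 3 L → Fin 3 → ℝ), |cΘ L β p.1 * cM L β p.1 p.2 * cΘ L β p.2| ≤ CM := fun p => by
    rw [abs_mul, abs_mul]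
    have hC0 : 0 ≤ CM := (abs_nonneg _).trans (hCM p.1 p.2).2.2
    have h12 : |cΘ L β p.1| * |cM L β p.1 p.2| ≤ CM := by
      calc |cΘ L β p.1| * |cM L β p.1 p.2| ≤ 1 * CM := mul_le_mul (hΘ1 _) (hCM _ _).2.2 (abs_nonneg _) zero_le_one
        _ = CM := one_mul _
    calc |cΘ L β p.1| * |cM L β p.1 p.2| * |cΘ L β p.2| ≤ CM * 1 := mul_le_mul h12 (hΘ1 _) (abs_nonneg _) hC0
      _ = CM := mul_one _
  have hG : Measurable fun p : (Edge 3 L → Fin 3 → ℝ) × (Edge 3 L → Fin 3 → ℝ) =>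
      3 / 2 * cA L β * (cΘ L β p.1 * cK L β p.1 p.2 * cΘ L β p.2) + t * (cΘ L β p.1 * cΘ L β p.2) :=
    ((((hΘm.comp measurable_fst).mul hKm).mul (hΘm.comp measurable_snd)).const_mul _).add (((hΘm.comp measurable_fst).mul (hΘm.comp measurable_snd)).const_mul _)
  have hG1 : ∀ p : (Edge 3 L → Fin 3 → ℝ) × (Edge 3 L → Fin 3 → ℝ), |cΘ L β p.1 * cK L β p.1 p.2 * cΘ L β p.2| ≤ 1 := fun p => by
    rw [abs_mul, abs_mul]; exact mul_le_one₀ (mul_le_one₀ (hΘ1 _) (abs_nonneg _) (hK1 _ _)) (abs_nonneg _) (hΘ1 _)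
  have hG2 : ∀ p : (Edge 3 L → Fin 3 → ℝ) × (Edge 3 L → Fin 3 → ℝ), |cΘ L β p.1 * cΘ L β p.2| ≤ 1 := fun p => by
    rw [abs_mul]; exact mul_le_one₀ (hΘ1 _) (abs_nonneg _) (hΘ1 _)
  have hGb : ∀ p : (Edge 3 L → Fin 3 → ℝ) × (Edge 3 L → Fin 3 → ℝ),
      |3 / 2 * cA L β * (cΘ L β p.1 * cK L β p.1 p.2 * cΘ L β p.2) + t * (cΘ L β p.1 * cΘ L β p.2)| ≤ 3 / 2 * cA L β + t := fun p => by
    calc _ ≤ |3 / 2 * cA L β * (cΘ L β p.1 * cK L β p.1 p.2 * cΘ L β p.2)| + |t * (cΘ L β p.1 * cΘ L β p.2)| := abs_add_le _ _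
      _ = 3 / 2 * cA L β * |cΘ L β p.1 * cK L β p.1 p.2 * cΘ L β p.2| + t * |cΘ L β p.1 * cΘ L β p.2| := by
          rw [abs_mul, abs_mul t, abs_of_nonneg (by positivity : (0:ℝ) ≤ 3 / 2 * cA L β), abs_of_nonneg ht0]
      _ ≤ 3 / 2 * cA L β * 1 + t * 1 := add_le_add (mul_le_mul_of_nonneg_left (hG1 p) (by positivity)) (mul_le_mul_of_nonneg_left (hG2 p) ht0)
      _ = 3 / 2 * cA L β + t := by ring
  have hmono := iter_integral_mono (μ := orthoTransverse L) (ν := orthoTransverse L) hF hFb hG hGb hpt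
  have hlin := iter_integral_lin (L := L) (F := fun p => cΘ L β p.1 * cK L β p.1 p.2 * cΘ L β p.2) (G := fun p => cΘ L β p.1 * cΘ L β p.2)
    (((hΘm.comp measurable_fst).mul hKm).mul (hΘm.comp measurable_snd)) hG1 ((hΘm.comp measurable_fst).mul (hΘm.comp measurable_snd)) hG2 (3 / 2 * cA L β) t
  dsimp only at hmono hlin
  rw [hlin, iter_integral_cΘ_sq] at hmono
  have hNle : N ≤ 3 / 2 * cA L β * cIk L β + t * (∫ x, cΘ L β x ∂orthoTransverse L) ^ 2 := hmono
  -- cΛK·cZK = N or 0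
  have hΛ : cΛK L s K M β = N / cZK L s K M β := rfl
  by_cases hZ : cZK L s K M β = 0
  · rw [hZ, mul_zero]; exact hRHS0
  · rw [hΛ, div_mul_cancel₀ _ hZ]; exact hNle

/-- ★★ **`cΛK·cZK ≤ 3·cA·cIk`** eventually in `β`, for all `s, M`. [cite: Luscher1983, §3] -/
theorem cLambdaK_mul_cZK_le_three (hL : Nonempty (NzSite L)) : ∀ᶠ β : ℝ in atTop, ∀ s K M : ℝ, cΛK L s K M β * cZK L s K M β ≤ 3 * cA L β * cIk L β := by
  filter_upwards [cLambdaK_mul_cZK_le (L := L) hL, tail_le_cIk (L := L)] with β h1 h2 s K M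
  have := h1 s K M; linarith

/-- ★★★ **THE JUMP FLOOR `hJ` WITH `cJ = 1/6`**: for `L` with a non-zero site, eventually in `β`, for all `s, M, x, y`:
`(1/6)·(cΛK L s K M β · cJ0K L s K M β x y) ≤ cΘ L β x · cM L β x y · cΘ L β y`. [cite: Luscher1983, §3] [cite: SjostrandZworski2007, §2] -/
theorem hJ_record_K (hL : Nonempty (NzSite L)) :
    ∀ᶠ β : ℝ in atTop, ∀ s K M : ℝ, ∀ x y : Edge 3 L → Fin 3 → ℝ, 1 / 6 * (cΛK L s K M β * cJ0K L s K M β x y) ≤ cΘ L β x * cM L β x y * cΘ L β y := by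
  filter_upwards [cLambdaK_mul_cZK_le_three (L := L) hL, cM_lower (L := L) hL (by norm_num : (0 : ℝ) < 1 / 2), eventually_ge_atTop (0 : ℝ)] with β h3 hlow hβ s K M x y
  obtain ⟨-, -, hΘ0⟩ := cΘ_data (L := L) β
  by_cases hx : x ∈ cS L β
  · by_cases hy : y ∈ cS L β
    · have hI := cIk_pos (L := L) hβ
      have hK0 := (cK_pos_le_one (L := L) hβ x y).1
      have hlo := hlow x hx y hy
      change (1 - 1 / 2) * (cA L β * cK L β x y) ≤ cM L β x y at hlo
      have hΘΘ : 0 ≤ cΘ L β x * cK L β x y * cΘ L β y := mul_nonneg (mul_nonneg (hΘ0 x) hK0.le) (hΘ0 y)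
      -- cΛK·cJ0K = (cΛK·cZK)/cIk · ΘKΘ ≤ 3cA·ΘKΘ
      have e : cΛK L s K M β * cJ0K L s K M β x y = (cΛK L s K M β * cZK L s K M β) / cIk L β * (cΘ L β x * cK L β x y * cΘ L β y) := by
        unfold cJ0K; field_simp
      have h1 : cΛK L s K M β * cJ0K L s K M β x y ≤ 3 * cA L β * (cΘ L β x * cK L β x y * cΘ L β y) := by
        rw [e]
        exact mul_le_mul_of_nonneg_right ((div_le_iff₀ hI).2 (h3 s K M)) hΘΘ
      have h2 : cΘ L β x * (1 / 2 * (cA L β * cK L β x y)) * cΘ L β y ≤ cΘ L β x * cM L β x y * cΘ L β y := by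
        have : (1 - 1 / 2 : ℝ) = 1 / 2 := by norm_num
        rw [this] at hlo
        exact mul_le_mul_of_nonneg_right (mul_le_mul_of_nonneg_left hlo (hΘ0 x)) (hΘ0 y)
      nlinarith
    · have hΘy : cΘ L β y = 0 := cΘ_eq_zero_of_not_mem_cS β y hy
      unfold cJ0K; rw [hΘy]; simp
  · have hΘx : cΘ L β x = 0 := cΘ_eq_zero_of_not_mem_cS β x hx
    unfold cJ0K; rw [hΘx]; simp

/-! ## §3 ★★★ The flat Poincaré hypothesis at cap constant `K` -/

/-- `∫_{cS} cD dπ ≤ (1+ε)·cZK` from the pointwise density comparison on `cS`. [folklore] -/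
theorem setIntegral_cD_le_cZK {s K M β ε : ℝ} (hε : 0 ≤ ε) (hcmp : ∀ x ∈ cS L β, cD L β x ≤ (1 + ε) * (cΘ L β x ^ 2 * cWK L s K M β x)) :
    ∫ x in cS L β, cD L β x ∂orthoTransverse L ≤ (1 + ε) * cZK L s K M β := by
  haveI := isFiniteMeasure_orthoTransverse L
  obtain ⟨hDm, hDpos, hDb⟩ := cD_data (L := L) β
  obtain ⟨hWm, hWb, hW0⟩ := cWK_props (L := L) s K M β
  obtain ⟨hΘm, hΘb, hΘ0⟩ := cΘ_data (L := L) β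
  have hZ : cZK L s K M β = ∫ x in cS L β, cΘ L β x ^ 2 * cWK L s K M β x ∂orthoTransverse L := by
    unfold cZK
    exact (setIntegral_eq_integral_of_forall_compl_eq_zero fun x hx => by rw [cΘ_eq_zero_of_not_mem_cS β x hx]; ring).symm
  rw [hZ, ← integral_const_mul]
  have hb2 : ∀ x, |(1 + ε) * (cΘ L β x ^ 2 * cWK L s K M β x)| ≤ (1 + ε) * (1 * Real.exp ((Fintype.card (Edge 3 L) : ℝ) / powScale 1 β ^ 2)) := fun x => by
    rw [abs_mul, abs_of_nonneg (by linarith : (0 : ℝ) ≤ 1 + ε), abs_mul]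
    refine mul_le_mul_of_nonneg_left (mul_le_mul ?_ (hWb x) (abs_nonneg _) zero_le_one) (by linarith)
    rw [abs_pow]; have := hΘb x; nlinarith [abs_nonneg (cΘ L β x)]
  refine setIntegral_mono_on (integrable_of_measurable_abs_le _ hDm hDb).integrableOn
    (integrable_of_measurable_abs_le _ (measurable_const.mul ((hΘm.pow_const 2).mul hWm)) hb2).integrableOn (measurableSet_cS β) fun x hx => hcmp x hx

set_option maxHeartbeats 400000 in
/-- ★★★ **`hflat` FOR THE RECORD's CENTRAL FIBRE DOOR.**  For `L ≥ 2` with a non-zero site and `0 < s ≤ 1/3` there is `M₁` such that for every `M ≥ M₁`, with the β-FREE constant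
`P₀ = 8/(1 − ρ_L)`, `ρ_L = 1/(1+√(2 − 2cos(2π/L)))`, and every rate `δ > 0`, for all large `β` and every bounded measurable `g` vanishing off `cS β`:
`∫_{cS} g²cD dπ − (∫_{cS} g cD dπ)²/∫_{cS} cD dπ ≤ P₀·½∫∫ (g x − g y)²·cJ0K s M β x y dπ dπ + δ·∫_{cS} g²cD dπ` — verbatim the hypothesis `hflat` of ✓`spec_gap_inputs_of_hflat`.
[cite: Luscher1983, §3; Wipf2021, §8.5.1 (8.56)–(8.58)] -/
theorem hflat_record_K {K : ℝ} (hK : 1 ≤ K) (hLz : Nonempty (NzSite L)) (hL2 : 2 ≤ L) {s : ℝ} (hs0 : 0 < s) (hs3 : s ≤ 1 / 3) :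
    ∃ M₁ : ℝ, ∀ M : ℝ, M₁ ≤ M → ∃ P₀ : ℝ, 0 < P₀ ∧ ∀ δ : ℝ, 0 < δ → ∀ᶠ β : ℝ in atTop,
      ∀ g : (Edge 3 L → Fin 3 → ℝ) → ℝ, Measurable g → (∃ C : ℝ, ∀ x, |g x| ≤ C) → (∀ x, x ∉ cS L β → g x = 0) →
        (∫ x in cS L β, g x ^ 2 * cD L β x ∂orthoTransverse L) - (∫ x in cS L β, g x * cD L β x ∂orthoTransverse L) ^ 2 / (∫ x in cS L β, cD L β x ∂orthoTransverse L) ≤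
          P₀ * ((1 / 2) * ∫ x, ∫ y, (g x - g y) ^ 2 * cJ0K L s K M β x y ∂orthoTransverse L ∂orthoTransverse L) + δ * ∫ x in cS L β, g x ^ 2 * cD L β x ∂orthoTransverse L := by
  obtain ⟨M₀, -, hcmp⟩ := central_density_compare_K (L := L) hK hLz hs0 hs3
  refine ⟨M₀, fun M hM => ?_⟩
  -- the β-free contraction bound and Poincaré constant
  set ρ : ℝ := 1 / (1 + Real.sqrt (2 - 2 * Real.cos (2 * Real.pi / L))) with hρdef
  obtain ⟨hρ0, hρ1⟩ : 0 ≤ ρ ∧ ρ < 1 := flatRho_lt_one (L := L) hL2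
  have hP : 0 < 2 / (1 - ρ) := div_pos two_pos (by linarith)
  refine ⟨4 * (2 / (1 - ρ)), by linarith, fun δ hδ => ?_⟩
  -- eventualities
  obtain ⟨ρ₀, hρ₀, hsharp⟩ := orthoTransverse_restrict_cS_sharp L
  have hsum : Tendsto (fun β : ℝ => (2 * (Fintype.card (StiffIdx L β) : ℝ) *
      Real.exp (-(Real.pi * ((1 - ρ) * min (1 / 40) (powScale (1 / 2) β * btLog β) / (2 * Real.sqrt (∑ k : StiffIdx L β, flatScale L β k ^ 2))) ^ 2)) +
      (∫ z in (Metric.closedBall (0 : gaugeModes L) ((1 - ρ) * min (1 / 40) (powScale (1 / 2) β * btLog β) / 2))ᶜ ∩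
          Metric.closedBall (0 : gaugeModes L) (min (1 / 40) (powScale (1 / 2) β * btLog β)), Real.exp (-(‖z‖ ^ 2 / powScale 1 β ^ 2))) /
        (∫ z in Metric.closedBall (0 : gaugeModes L) (min (1 / 40) (powScale (1 / 2) β * btLog β)), Real.exp (-(‖z‖ ^ 2 / powScale 1 β ^ 2)))) +
      2 * (Fintype.card (StiffIdx L β) : ℝ) *
        Real.exp (-(Real.pi * ((1 - ρ) * (min (1 / 40) (powScale (1 / 2) β * btLog β) * Real.sqrt (49 * β / Real.pi))) ^ 2))) atTop (𝓝 0) := by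
    simpa using ((tendsto_epsCore (L := L) hL2 hρ1).add (tendsto_gaugeTail (L := L) hρ1)).add (tendsto_epsR (L := L) hρ1)
  have hθ : 0 < min (1 / 4) (δ / (2 * (2 / (1 - ρ)))) := lt_min (by norm_num) (div_pos hδ (mul_pos two_pos hP))
  filter_upwards [eventually_action_hessian_cS (L := L) (ε := 1 / 16) (by norm_num), hcmp M hM (1 / 8) (by norm_num), hsharp (1 / 8) (by norm_num),
    eventually_ge_atTop (1 : ℝ), hsum.eventually (eventually_le_nhds hθ)]
    with β hη hcmpβ hsh hβ1 hsmall g hg hgC hgS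
  obtain ⟨hlo, hup⟩ := hsh
  obtain ⟨Cg, hgb⟩ := hgC
  have hβ : 0 < β := by linarith
  haveI := isFiniteMeasure_orthoTransverse L
  -- the flat measure `ν` and its comparison with `π` on `cS β`
  haveI := isAddHaarMeasure_volume_flat (L := L) β
  obtain ⟨κ, hκ, hbal⟩ := balLebesgue_eq_smul_map L (volume : Measure ((StiffIdx L β → ℝ) × gaugeModes L)) (T := flatMap L β) (flatMap_injective hβ) (range_flatMap hβ)
  set ν : Measure (Edge 3 L → Fin 3 → ℝ) := Measure.map (flatMap L β) volume with hν
  have hk : ∀ a : ℝ, 0 ≤ a → ENNReal.ofReal a • (balLebesgue L).restrict (cS L β) = ENNReal.ofReal (a * κ) • ν.restrict (cS L β) := fun a ha => by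
    rw [hbal, Measure.restrict_smul, smul_smul, ENNReal.ofReal_mul ha, ENNReal.ofReal_coe_nnreal]
  set c : ℝ := (1 - 1 / 8) * ρ₀ * κ with hc
  set C : ℝ := (1 + 1 / 8) * ρ₀ * κ with hC
  have hκ' : (0 : ℝ) < κ := by exact_mod_cast hκ
  have hc0 : 0 < c := by positivity
  have hC0 : 0 ≤ C := by positivity
  have hlo' : ENNReal.ofReal c • ν.restrict (cS L β) ≤ (orthoTransverse L).restrict (cS L β) := by rw [hc, ← hk ((1 - 1 / 8) * ρ₀) (by positivity)]; exact hlo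
  have hup' : (orthoTransverse L).restrict (cS L β) ≤ ENNReal.ofReal C • ν.restrict (cS L β) := by rw [hC, ← hk ((1 + 1 / 8) * ρ₀) (by positivity)]; exact hup
  -- `I_ν > 0` from `cIk > 0`
  obtain ⟨hGm, hG0, hGb, hGS⟩ := trueKernel_data (L := L) hβ.le
  have hIcmp : cIk L β ≤ C ^ 2 * ∫ x in cS L β, ∫ y in cS L β, cΘ L β x * cK L β x y * cΘ L β y ∂ν ∂ν := by
    unfold cIk; exact StiffDoor.jumpForm_ge_of_comparison hc0 hC0 hlo' hup' hGm hG0 (fun x y => (le_abs_self _).trans (hGb x y)) hGS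
  have hIk := cIk_pos (L := L) hβ.le
  have hIν : 0 < ∫ x in cS L β, ∫ y in cS L β, cΘ L β x * cK L β x y * cΘ L β y ∂ν ∂ν := by
    have hC2 : 0 < C ^ 2 := by positivity
    by_contra hneg
    have : C ^ 2 * ∫ x in cS L β, ∫ y in cS L β, cΘ L β x * cK L β x y * cΘ L β y ∂ν ∂ν ≤ 0 := mul_nonpos_of_nonneg_of_nonpos hC2.le (not_lt.mp hneg)
    linarith
  -- the pushforward of the flat model
  obtain ⟨hRpos, hRr, ht, hfit⟩ := core_fit (L := L) hL2 hβ hρ0 hρ1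
  have hρk : ∀ k : StiffIdx L β, flatB L β k / (flatA L β k + flatB L β k + Real.pi) ≤ ρ := fun k => flatRatio_le hL2 hβ k
  -- the three exit masses at `β`
  set eC : ℝ := 2 * (Fintype.card (StiffIdx L β) : ℝ) *
      Real.exp (-(Real.pi * ((1 - ρ) * min (1 / 40) (powScale (1 / 2) β * btLog β) / (2 * Real.sqrt (∑ k : StiffIdx L β, flatScale L β k ^ 2))) ^ 2)) with heC
  set eG : ℝ := (∫ z in (Metric.closedBall (0 : gaugeModes L) ((1 - ρ) * min (1 / 40) (powScale (1 / 2) β * btLog β) / 2))ᶜ ∩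
          Metric.closedBall (0 : gaugeModes L) (min (1 / 40) (powScale (1 / 2) β * btLog β)), Real.exp (-(‖z‖ ^ 2 / powScale 1 β ^ 2))) /
        (∫ z in Metric.closedBall (0 : gaugeModes L) (min (1 / 40) (powScale (1 / 2) β * btLog β)), Real.exp (-(‖z‖ ^ 2 / powScale 1 β ^ 2))) with heG
  set eR : ℝ := 2 * (Fintype.card (StiffIdx L β) : ℝ) *
        Real.exp (-(Real.pi * ((1 - ρ) * (min (1 / 40) (powScale (1 / 2) β * btLog β) * Real.sqrt (49 * β / Real.pi))) ^ 2)) with heR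
  have heC0 : 0 ≤ eC := by positivity
  have heG0 : 0 ≤ eG := div_nonneg (integral_nonneg fun z => (Real.exp_pos _).le) (integral_nonneg fun z => (Real.exp_pos _).le)
  have heR0 : 0 ≤ eR := by positivity
  have hεR : eR ≤ 1 / 4 := by linarith [hsmall.trans (min_le_left _ _)]
  have hεS : eC + eG ≤ 1 / 4 := by linarith [hsmall.trans (min_le_left _ _)]
  have hpf := hflat_pushforward (L := L) hβ1 hη hρ0 hρk hρ1 hRpos hRr ht hfit hεR hεS hIν hg hgb hgS
  -- the kernel domination `cΘcKcΘ'·Z_ν/I_ν ≤ K·cJ0K`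
  obtain ⟨hDm, hDpos, hDb⟩ := cD_data (L := L) β
  have hZ : c * ∫ x in cS L β, cD L β x ∂ν ≤ ∫ x in cS L β, cD L β x ∂orthoTransverse L :=
    StiffDoor.setIntegral_ge_of_comparison hc0 hlo' hDm (fun x => (hDpos x).le) fun x => (le_abs_self _).trans (hDb x)
  have hZπ0 : 0 ≤ ∫ x in cS L β, cD L β x ∂orthoTransverse L := integral_nonneg fun x => (hDpos x).le
  have hratio := StiffDoor.ratio_le_of_two_sided (C := C) hc0 hZ hIcmp hIν hIk hZπ0
  have hZπ : ∫ x in cS L β, cD L β x ∂orthoTransverse L ≤ (1 + 1 / 8) * cZK L s K M β := setIntegral_cD_le_cZK (L := L) (by norm_num) fun x hx => (hcmpβ x hx).2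
  set Kq : ℝ := C ^ 2 / c * (1 + 1 / 8) with hKq
  have hJK : ∀ x y, cΘ L β x * cK L β x y * cΘ L β y *
      ((∫ z in cS L β, cD L β z ∂ν) / ∫ z in cS L β, ∫ w in cS L β, cΘ L β z * cK L β z w * cΘ L β w ∂ν ∂ν) ≤ Kq * cJ0K L s K M β x y := by
    intro x y
    have h1 : (∫ z in cS L β, cD L β z ∂ν) / (∫ z in cS L β, ∫ w in cS L β, cΘ L β z * cK L β z w * cΘ L β w ∂ν ∂ν) ≤ C ^ 2 / c * ((1 + 1 / 8) * (cZK L s K M β / cIk L β)) := by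
      refine hratio.trans (mul_le_mul_of_nonneg_left ?_ (by positivity))
      rw [mul_div_assoc']; exact div_le_div_of_nonneg_right hZπ hIk.le
    unfold cJ0K
    calc cΘ L β x * cK L β x y * cΘ L β y * ((∫ z in cS L β, cD L β z ∂ν) / ∫ z in cS L β, ∫ w in cS L β, cΘ L β z * cK L β z w * cΘ L β w ∂ν ∂ν)
        ≤ cΘ L β x * cK L β x y * cΘ L β y * (C ^ 2 / c * ((1 + 1 / 8) * (cZK L s K M β / cIk L β))) := mul_le_mul_of_nonneg_left h1 (hG0 x y)
      _ = Kq * (cΘ L β x * cK L β x y * cΘ L β y * (cZK L s K M β / cIk L β)) := by rw [hKq]; ring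
  -- transport to `π`
  have hJ₁m : Measurable (Function.uncurry fun x y => cΘ L β x * cK L β x y * cΘ L β y *
      ((∫ z in cS L β, cD L β z ∂ν) / ∫ z in cS L β, ∫ w in cS L β, cΘ L β z * cK L β z w * cΘ L β w ∂ν ∂ν)) := hGm.mul measurable_const
  have hZν0 : 0 ≤ ∫ z in cS L β, cD L β z ∂ν := integral_nonneg fun x => (hDpos x).le
  have hJ₁0 : ∀ x y, 0 ≤ cΘ L β x * cK L β x y * cΘ L β y *
      ((∫ z in cS L β, cD L β z ∂ν) / ∫ z in cS L β, ∫ w in cS L β, cΘ L β z * cK L β z w * cΘ L β w ∂ν ∂ν) := fun x y => mul_nonneg (hG0 x y) (div_nonneg hZν0 hIν.le)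
  have hJ₁b : ∀ x y, |cΘ L β x * cK L β x y * cΘ L β y *
      ((∫ z in cS L β, cD L β z ∂ν) / ∫ z in cS L β, ∫ w in cS L β, cΘ L β z * cK L β z w * cΘ L β w ∂ν ∂ν)| ≤
        1 * |(∫ z in cS L β, cD L β z ∂ν) / ∫ z in cS L β, ∫ w in cS L β, cΘ L β z * cK L β z w * cΘ L β w ∂ν ∂ν| := fun x y => by
    rw [abs_mul]; exact mul_le_mul_of_nonneg_right (hGb x y) (abs_nonneg _)
  have hJ₁S : ∀ x y, cΘ L β x * cK L β x y * cΘ L β y *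
      ((∫ z in cS L β, cD L β z ∂ν) / ∫ z in cS L β, ∫ w in cS L β, cΘ L β z * cK L β z w * cΘ L β w ∂ν ∂ν) ≠ 0 → x ∈ cS L β ∧ y ∈ cS L β :=
    fun x y h => hGS x y (left_ne_zero_of_mul h)
  have hvc := vacCoef_pos (σ := StiffIdx L β)
  have hP₀' : 0 ≤ vacCoef (StiffIdx L β) ^ 2 * Real.exp (2 * (1 / 16)) * (Real.exp (2 * (1 / 16)) / vacCoef (StiffIdx L β) ^ 2) * (2 / (1 - ρ)) := mul_nonneg (by positivity) hP.le
  have hδ' : 0 ≤ 2 / (1 - ρ) * (eC + eG + eR) := mul_nonneg hP.le (by linarith)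
  have htr := StiffDoor.poincare_transport_of_kernel_le (μ := orthoTransverse L) (ν := ν) (S := cS L β) hc0 hC0 hlo' hup' hg hgb hDm hDb (fun x => (hDpos x).le)
    hJ₁m hJ₁b hJ₁0 hJ₁S (measurable_cJ0K (L := L) s K M β) (abs_cJ0K_le (L := L) hβ.le s K M) hJK hP₀' hδ' hpf
  -- the constants
  have hJF0 : 0 ≤ ∫ x, ∫ y, (g x - g y) ^ 2 * cJ0K L s K M β x y ∂orthoTransverse L ∂orthoTransverse L :=
    integral_nonneg fun x => integral_nonneg fun y => mul_nonneg (sq_nonneg _) (by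
      unfold cJ0K; exact mul_nonneg (hG0 x y) (div_nonneg (cZK_nonneg (L := L) s K M β) hIk.le))
  have hN0 : 0 ≤ ∫ x in cS L β, g x ^ 2 * cD L β x ∂orthoTransverse L := integral_nonneg fun x => mul_nonneg (sq_nonneg _) (hDpos x).le
  have hCc : C / c = 9 / 7 := by rw [hC, hc]; field_simp; norm_num
  have he4 : Real.exp (2 * (1 / 16)) * Real.exp (2 * (1 / 16)) ≤ 4 / 3 := by
    rw [← Real.exp_add]; refine (Real.exp_bound_div_one_sub_of_interval (by norm_num) (by norm_num)).trans ?_; norm_num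
  have hcoefP : C / c ^ 2 * Kq * (vacCoef (StiffIdx L β) ^ 2 * Real.exp (2 * (1 / 16)) * (Real.exp (2 * (1 / 16)) / vacCoef (StiffIdx L β) ^ 2) * (2 / (1 - ρ))) ≤
      4 * (2 / (1 - ρ)) := by
    have hρ1' : (1 : ℝ) - ρ ≠ 0 := by linarith
    have e1 : C / c ^ 2 * Kq * (vacCoef (StiffIdx L β) ^ 2 * Real.exp (2 * (1 / 16)) * (Real.exp (2 * (1 / 16)) / vacCoef (StiffIdx L β) ^ 2) * (2 / (1 - ρ))) =
        (C / c) ^ 3 * (1 + 1 / 8) * (Real.exp (2 * (1 / 16)) * Real.exp (2 * (1 / 16))) * (2 / (1 - ρ)) := by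
      rw [hKq]; field_simp
    rw [e1, hCc]
    have h2 : (9 / 7 : ℝ) ^ 3 * (1 + 1 / 8) * (Real.exp (2 * (1 / 16)) * Real.exp (2 * (1 / 16))) ≤ (9 / 7 : ℝ) ^ 3 * (1 + 1 / 8) * (4 / 3) := by gcongr
    have h3 : (9 / 7 : ℝ) ^ 3 * (1 + 1 / 8) * (4 / 3) ≤ 4 := by norm_num
    exact mul_le_mul_of_nonneg_right (h2.trans h3) hP.le
  have hcoefδ : C / c * (2 / (1 - ρ) * (eC + eG + eR)) ≤ δ := by
    rw [hCc]
    have h1 : eC + eG + eR ≤ δ / (2 * (2 / (1 - ρ))) := hsmall.trans (min_le_right _ _)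
    rw [le_div_iff₀ (mul_pos two_pos hP)] at h1
    have hE0 : 0 ≤ eC + eG + eR := by linarith
    calc 9 / 7 * (2 / (1 - ρ) * (eC + eG + eR)) ≤ 2 * (2 / (1 - ρ) * (eC + eG + eR)) := mul_le_mul_of_nonneg_right (by norm_num) (mul_nonneg hP.le hE0)
      _ = (eC + eG + eR) * (2 * (2 / (1 - ρ))) := by ring
      _ ≤ δ := h1
  have hJF0' : (0 : ℝ) ≤ (1 / 2) * ∫ x, ∫ y, (g x - g y) ^ 2 * cJ0K L s K M β x y ∂orthoTransverse L ∂orthoTransverse L := mul_nonneg (by norm_num) hJF0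
  exact htr.trans (add_le_add (mul_le_mul_of_nonneg_right hcoefP hJF0') (mul_le_mul_of_nonneg_right hcoefδ hN0))

end Summit.QuantumFields.YangMills.Theorems.FemtoTransferGap.TwoLattice.ConstTube

end
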